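import Summits.Ventures.Crystal3D.StickySpheres.Asymptotics
import Summits.Ventures.Crystal3D.Statement
import Summits.Ventures.Crystal3D.Bulk.DefectCounting
import Literature.Geometry.DiscreteGeometry.FejesTothKissingTwelve
import HarnessLib

/-!
# Bulk crystallization of sticky hard spheres in `ℝ³`: the statement and its reduction to `L12(1)`

HONEST FRAMING. Part of the venture `Summits/Ventures/Crystal3D` (cell `pub-crystal3d`, phase 2).
This file TYPES the cell's phase-2 proposition `BulkCrystallization3D K` ("all but `K · N^{2/3}`
balls of every contact-maximising packing of `N` hard unit spheres have a close-packed — fcc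
(cuboctahedral) or hcp (anticuboctahedral) — first coordination shell") over the phase-1
vocabulary (`IsUnitPacking`, `contactNeighbors`, `coordination`, `numContacts`, `maxContacts`,
`IsStickyGroundState`; contact distance `1`), the LOCAL twelve-neighbour lemma `L12Local` on
which it hinges, and PROVES the reduction
`bulkCrystallization3D_of_L12Local : L12Local → BulkCrystallization3D 1296` outright, by
counting. NO crystallization theorem is claimed: `L12Local` is OUR definition of a statement whose
status in print is recorded in its docstring (a reading of the proof of Hales 2012, Theorem 1;
equivalently Flatley–Tarasov–Taylor–Theil 2013, Theorem 4 + their open Conjecture 2), NOT a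
Literature fact; the companion file `Bulk/LocalTwelveOfHales.lean` derives it from the tree's
named computer-assisted facts `flyspeck_L12` and `Hales2012_kissingConfigCongruent`.

STATUS (docstring refresh 2026-08-26; no declaration of this file changed): the statement typed
here is now PROVED with `K = 130` elsewhere in the tree — `bulkCrystallization3D_130 :
BulkCrystallization3D 130` (`Kissing125/Classification.lean`), a hypothesis-free tree theorem of
COMPUTATIONAL grade (see the docstring of `BulkCrystallization3D` for the exact axiom closure).
This file's own content (the `L12Local` reduction with `K = 1296`, the handshake / deficit
counting) is unchanged and remains the elementary layer the sharper files build on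
(`Bulk/GapReduction.lean`, `Bulk/SharperConstant.lean`, `Bulk/GapReductionSharp.lean`). `L12Local`
itself follows in the tree from GAP(1.25) (`gapTupleDiam_125`, `Bulk/GapLadderComputational.lean`,
computational) and CLASSIFICATION(5/2) (`kissingClassification_250`, computational) through the
dictionary of `Bulk/GapReduction.lean` (`gapTupleDiam_iff`, `kissingGap_of_gapTuple`,
`l12Local_of_gap_of_classification`); it is no longer merely "a reading of a proof".

## Contents (namespace `Summit.Ventures.Crystal3D`)

* `contactShell x i` — the first coordination shell of ball `i`: the set of DOUBLED offset
  vectors `2 (x j - x i)`, `j` a contact neighbour of `i`. Touching unit-diameter balls have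
  centres at distance `1`, so these are points of Hales's sphere `S²(2)`; with this normalisation
  the shell is LITERALLY the `kissingShell` (Hales 2012, Definition 1, tree file
  `Literature/Geometry/DiscreteGeometry/FejesTothKissingTwelve.lean`) of the doubled packing, and
  the tree's vocabulary `IsArrangedIn` / `IsKissingConfig` / `Hales2012_kissingConfigCongruent`
  applies verbatim (no second rendering of "congruent to the FCC/HCP pattern" is introduced).
* `IsClosePackedShell x i` — the shell of `i` `IsArrangedIn` the FCC pattern (`fccKissingPattern`,
  cuboctahedron) or the HCP pattern (`hcpKissingPattern`, anticuboctahedron): ball `i` is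
  "fcc/hcp-local". `nonClosePacked x` — the finset of balls that are not.
* `BulkCrystallization3D K` — the phase-2 target with explicit constant `K`.
* `L12Local` — the local twelve-neighbour lemma `L12(1)`.
* PROVED: the handshake in deficit form `∑ (12 - deg) + 2E = 12N`; `#{deg ≠ 12} ≤ 12N - 2E`;
  the counting lemma `card_le_of_localTwelve` (`#S ≤ 12 (12N - 2E)` for every set `S` of balls
  each of which is under-coordinated or has an under-coordinated neighbour); the fcc deficit bound
  `6N - 54 N^{2/3} ≤ C(N)` (from `maxContacts_div_ge`); hence, UNCONDITIONALLY, in every sticky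
  ground state all but `108 · N^{2/3}` balls have exactly twelve contacts
  (`card_coordination_ne_twelve_le_of_groundState`), and `L12Local → BulkCrystallization3D 1296`.

## The counting (referee-2 of the cell, R2-1; every step elementary)

Let `x` be a packing of `N` balls with `E` contacts, `A = {i : deg i ≠ 12}` (`= {deg i ≤ 11}` by
the kissing number), `S` any set of balls each of which lies in `A` or has a neighbour in `A`.
(a) `∑ᵢ (12 - deg i) = 12N - 2E ≥ |A|`. (b) `S ⊆ A ∪ ⋃_{a ∈ A} N(a)` and `|N(a)| ≤ 11` for
`a ∈ A`, so `|S| ≤ 12 |A| ≤ 12 (12N - 2E) = 24 (6N - E)`. (c) For a contact MAXIMISER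
`E = C(N) ≥ 6N - 54 N^{2/3}` (fcc pieces, tree theorem `maxContacts_div_ge`), so
`|S| ≤ 1296 · N^{2/3}`. Under `L12Local` the set of non-close-packed balls is such an `S`.

## Sources (as printed; prose citations, these are NOT vendored facts)

* R. C. Heitmann, C. Radin, J. Stat. Phys. 22 (1980) 281–287, Theorem p. 284: the 2D model —
  sticky-disc ground states are subsets of the triangular lattice (bulk AND surface); the
  `N^{1/2}` law of the 2D surface term: Harborth 1974; Au Yeung–Friesecke–Schmidt, Calc. Var. 44
  (2012); Schmidt, J. Stat. Phys. 153 (2013); De Luca–Friesecke (2017).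
* T. C. Hales, arXiv:1209.6043 (2012), Theorem 1: "Let `V` be a packing with kissing number
  twelve. Then for every point `u ∈ V`, the set of twelve around that point is arranged in the
  pattern of the HCP or FCC packing" (GLOBAL hypothesis; tree: `Hales2012_kissingTwelve`).
* L. Flatley, A. Tarasov, M. Taylor, F. Theil, J. Comput. Appl. Math. 254 (2013) 220–225,
  Theorem 4 (at most `24` tangencies among `≤ 12` kissing points, equality only for the
  cuboctahedron / twisted cuboctahedron; tree: `KissingContactMaximum.lean`) and Conjecture 2
  (OPEN as printed: touching 12-coordinated balls share `≥ 4` neighbours).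
* T. C. Hales, *Dense Sphere Packings* (2012), §1.3, Fig. 1.11 (the FCC and HCP patterns).

## Design notes

* `K` is explicit (`BulkCrystallization3D K`), antitone use: larger `K` is weaker
  (`BulkCrystallization3D.mono`). `1296 = 24 · 54` is crude (the `54` is the crude fcc-chunk
  constant of `Asymptotics.lean`); improving it is not a goal of this file.
* Real powers are `Real.rpow` of the non-negative base `N`; at `N = 0` both sides are `0`.
* `nonClosePacked` is a classical `Finset.filter`; membership lemma `mem_nonClosePacked`.
* Stacking faults are ALLOWED: hcp- and fcc-shells both count as close-packed (Barlow
  environments), as in the cell's charter; nothing positional/global is asserted.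
-/

noncomputable section

open scoped BigOperators
open Finset

namespace Summit.Ventures.Crystal3D

open Literature.Geometry.DiscreteGeometry (fccKissingPattern hcpKissingPattern
  card_fccKissingPattern card_hcpKissingPattern IsArrangedIn IsArrangedIn.ncard_eq
  ncard_eq_twelve_of_isArrangedIn)

variable {N : ℕ}

/-! ## Close-packed first shells -/

/-- The **contact shell** of ball `i`, in Hales's normalisation: the set of doubled vectors
`2 (x j - x i)` from the centre of `i` to the centres of its contact neighbours `j`. Touching
centres of unit-diameter balls are at distance `1`, so these are points of the sphere `S²(2)` —
"the set of twelve around that point", recentred at the origin and scaled to Hales's unit-RADIUS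
balls (Hales 2012, Definition 1); it is the tree's `kissingShell` of the doubled packing (bridge
file `Bulk/LocalTwelveOfHales.lean`). -/
def contactShell (x : Fin N → EuclideanSpace ℝ (Fin 3)) (i : Fin N) :
    Set (EuclideanSpace ℝ (Fin 3)) :=
  (fun j => (2 : ℝ) • (x j - x i)) '' (contactNeighbors x i : Set (Fin N))

/-- Ball `i` has a **close-packed first shell**: its contact shell is arranged (tree predicate
`IsArrangedIn T P := ∃ A : ℝ³ →ₗᵢ[ℝ] ℝ³, T = {2 • A p : p ∈ P}`, Hales 2012 Lemma 10's
"congruent to the FCC or HCP configuration in `S²(2)`") in the FCC pattern (`fccKissingPattern`,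
the cuboctahedron `(±1, ±1, 0)/√2, …`) or in the HCP pattern (`hcpKissingPattern`, the
anticuboctahedron / twisted cuboctahedron) — the two "Barlow" twelve-neighbour environments of the
close packings of spheres (Hales, *Dense Sphere Packings* §1.3). Stacking is not constrained: both
patterns count. -/
def IsClosePackedShell (x : Fin N → EuclideanSpace ℝ (Fin 3)) (i : Fin N) : Prop :=
  IsArrangedIn (contactShell x i) fccKissingPattern ∨ IsArrangedIn (contactShell x i) hcpKissingPattern

open scoped Classical in
/-- The balls of `x` whose first shell is **not** close-packed (the "defects": under-coordinated
balls — in particular every ball at the surface — and twelve-coordinated balls with a non-Barlow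
shell). -/
def nonClosePacked (x : Fin N → EuclideanSpace ℝ (Fin 3)) : Finset (Fin N) :=
  univ.filter fun i => ¬ IsClosePackedShell x i

/-- Membership in `nonClosePacked`. -/
theorem mem_nonClosePacked {x : Fin N → EuclideanSpace ℝ (Fin 3)} {i : Fin N} :
    i ∈ nonClosePacked x ↔ ¬ IsClosePackedShell x i := by
  simp [nonClosePacked]

/-! ## The phase-2 proposition and the local lemma -/

/-- **Bulk crystallization of sticky hard spheres in `ℝ³`, with constant `K`**: in every sticky
ground state of `N` hard unit spheres — a unit packing with the maximal number `C(N)` of contacts —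
all but at most `K · N^{2/3}` balls have a close-packed (fcc or hcp) first coordination shell.
This is the bulk half of a Heitmann–Radin-type statement in three dimensions (Heitmann–Radin 1980
prove, in the plane, that sticky-disc ground states lie on the triangular lattice; the surface
exponent `2/3` replaces the planar `1/2` of Harborth / Au Yeung–Friesecke–Schmidt / Schmidt 2013;
the all-ball analogue is FALSE in `ℝ³` — already for six balls a sticky ground state need not be
a close-packed fragment, tree barrier
`Literature/Barriers/AtomisticToContinuum/StickySphereClusters.lean`).
STATUS (docstring refresh 2026-08-26; the `def` is unchanged): **PROVED for `K = 130`** —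
`bulkCrystallization3D_130 : BulkCrystallization3D 130` (`Kissing125/Classification.lean`,
p417685) is a HYPOTHESIS-FREE TREE THEOREM of COMPUTATIONAL grade: its axiom closure is
`[propext, Classical.choice, Quot.sound]` + EXACTLY 323 named kernel-evaluation axioms — 67
`CapX2.check*_W0625` (the GAP(1.25) interval checks) + 256 `KissingSearch.checkPart_eq_true_NNN`
(the K25 growth-search parts) — each the compiled (`native_decide`) evaluation of a Boolean
checker to `true`, the checkers' soundness theorems being standard-axioms tree theorems. Chain:
GAP(5/4) ∧ BIMODAL(5/4) (`kissingClassification_250 : KissingClassification (5/2)`) ⇒ the sharp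
(all-but-one) local lemma ⇒ `BulkCrystallization3D 130` via `Bulk/GapReductionSharp.lean`; the
conditional predecessor `bulkCrystallization3D_130_of_kissingClassification_250`
(`Bulk/BulkConstant130.lean`) stands untouched. LOWER BOUNDS (every step standard axioms): FALSE
for every `K < 167/600` (`not_bulkCrystallization3D_of_lt`, `Bulk/BulkExponentSharp.lean` — the
defect count of every packing of `N ≥ 2` balls exceeds `(167/600) · N^{2/3}`, so the exponent
`2/3` cannot be lowered) and for every `K ≤ 2.474` (`not_bulkCrystallization3D_of_le_2474`,
`Bulk/BulkConstantFloorEighteen.lean`). The route of THIS file —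
`bulkCrystallization3D_of_L12Local`, `K = 1296` from the local lemma `L12Local` — is the
historical first reduction, kept; it is not the one the head uses. Monotone in `K`
(`BulkCrystallization3D.mono`). Nothing is asserted about WHICH
balls are defective or about global (single-stacking / long-range positional) order; the LOCAL
radius-2 layered-order upgrade is `Bulk/PositionalOrder.lean` + `Bulk/RadiusTwoBarlowHolds.lean`,
with the hypothesis-free instance `positionalOrder130` (`Bulk/PositionalOrder130.lean`,
computational grade, the head's closure exactly). -/
def BulkCrystallization3D (K : ℝ) : Prop :=
  ∀ (N : ℕ) (x : Fin N → EuclideanSpace ℝ (Fin 3)), IsStickyGroundState x →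
    ((nonClosePacked x).card : ℝ) ≤ K * (N : ℝ) ^ ((2 : ℝ) / 3)

/-- **The local twelve-neighbour lemma `L12(1)`** (OUR definition; its STATUS is the point of the
cell's phase 2): in every finite packing of unit-diameter balls in `ℝ³`, a ball with twelve
contacts each of whose twelve contact neighbours also has twelve contacts has a close-packed
(fcc or hcp) first shell. IN PRINT: Hales, arXiv:1209.6043 (2012), Theorem 1, is the GLOBAL
statement ("Let `V` be a packing with kissing number twelve. Then for every point `u ∈ V`, the
set of twelve around that point is arranged in the pattern of the HCP or FCC packing"); the
cell's referee-2 reads its PROOF as using the global hypothesis only through Lemma 2 at `u` and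
at its twelve neighbours, i.e. as proving this local form — a reading of a proof, made formal in
`Bulk/LocalTwelveOfHales.lean` (`l12Local_of_hales : flyspeck_L12 →
Hales2012_kissingConfigCongruent → L12Local`, both hypotheses computer-assisted named facts of the
tree). Flatley–Tarasov–Taylor–Theil 2013 remark that their Theorem 4 together with their (open)
Conjecture 2 would also give it. Not a Literature fact. STATUS (docstring refresh 2026-08-26): in
the tree it FOLLOWS from GAP(1.25) (`gapTupleDiam_125`, `Bulk/GapLadderComputational.lean`,
computational: 67 `CapX2.check*_W0625` evaluations) and CLASSIFICATION(5/2)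
(`kissingClassification_250`, `Kissing125/Classification.lean`, computational: 256
`KissingSearch.checkPart_eq_true_NNN` evaluations) via `Bulk/GapReduction.lean`
(`gapTupleDiam_iff`, `kissingGap_of_gapTuple`, `l12Local_of_gap_of_classification :
KissingGap δ → KissingClassification δ → L12Local`, standard axioms); the finite depth-2 census
once planned as its elementary certificate is not used by any tree theorem. -/
def L12Local : Prop :=
  ∀ (N : ℕ) (x : Fin N → EuclideanSpace ℝ (Fin 3)), IsUnitPacking x → ∀ i : Fin N, coordination x i = 12 →
    (∀ j ∈ contactNeighbors x i, coordination x j = 12) → IsClosePackedShell x i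

/-- A larger constant is a weaker statement: `BulkCrystallization3D` is monotone in `K`. -/
theorem BulkCrystallization3D.mono {K K' : ℝ} (h : K ≤ K') (hK : BulkCrystallization3D K) :
    BulkCrystallization3D K' := by
  intro N x hx
  have h1 := hK N x hx
  have h2 : K * (N : ℝ) ^ ((2 : ℝ) / 3) ≤ K' * (N : ℝ) ^ ((2 : ℝ) / 3) :=
    mul_le_mul_of_nonneg_right h (Real.rpow_nonneg (Nat.cast_nonneg N) _)
  linarith

/-! ## Elementary API of shells -/

variable {x : Fin N → EuclideanSpace ℝ (Fin 3)}

/-- Membership in the contact shell. -/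
theorem mem_contactShell {i : Fin N} {v : EuclideanSpace ℝ (Fin 3)} :
    v ∈ contactShell x i ↔ ∃ j ∈ contactNeighbors x i, (2 : ℝ) • (x j - x i) = v := by
  simp [contactShell]

/-- The contact shell lies on Hales's sphere `S²(2)`. -/
theorem norm_eq_two_of_mem_contactShell {i : Fin N} {v : EuclideanSpace ℝ (Fin 3)}
    (hv : v ∈ contactShell x i) : ‖v‖ = 2 := by
  obtain ⟨j, hj, rfl⟩ := mem_contactShell.1 hv
  rw [norm_smul, Real.norm_of_nonneg zero_le_two, ← dist_eq_norm, dist_comm,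
    ((mem_contactNeighbors x).1 hj).2, mul_one]

/-- The recentring-and-doubling map `j ↦ 2 (x j - x i)` is injective on the labels of a packing. -/
theorem two_smul_sub_injective (hx : IsUnitPacking x) (i : Fin N) :
    Function.Injective fun j => (2 : ℝ) • (x j - x i) := fun _ _ h =>
  hx.injective (sub_left_injective (smul_right_injective _ (two_ne_zero (α := ℝ)) h))

/-- Hence the contact shell of a packing has exactly `coordination x i` points. -/
theorem ncard_contactShell (hx : IsUnitPacking x) (i : Fin N) :
    (contactShell x i).ncard = coordination x i := by
  rw [contactShell, Set.ncard_image_of_injective _ (two_smul_sub_injective hx i),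
    Set.ncard_coe_finset, coordination]

/-- A ball of a packing with a close-packed shell has exactly twelve contacts. -/
theorem IsClosePackedShell.coordination_eq (hx : IsUnitPacking x) {i : Fin N}
    (h : IsClosePackedShell x i) : coordination x i = 12 := by
  rw [← ncard_contactShell hx i]
  exact ncard_eq_twelve_of_isArrangedIn h

/-! ## The counting -/

/-- **Handshake in deficit form**: in a packing of unit-diameter balls in `ℝ³`,
`∑ᵢ (12 - deg i) + 2 · C(x) = 12 N` (each `deg i ≤ 12` by the kissing number, so the natural
subtraction is exact). -/
theorem sum_twelve_sub_coordination_add (hx : IsUnitPacking x) :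
    ∑ i, (12 - coordination x i) + 2 * numContacts x = 12 * N := by
  rw [← sum_coordination_eq, ← sum_add_distrib]
  have h : ∀ i, 12 - coordination x i + coordination x i = 12 := fun i =>
    Nat.sub_add_cancel (coordination_le_twelve hx i)
  simp [h, mul_comm]

/-- The under-coordinated balls are paid for by the deficit: `#{i : deg i ≠ 12} ≤ ∑ᵢ (12 - deg i)`
(a ball with `deg ≠ 12` has `deg ≤ 11`). -/
theorem card_coordination_ne_twelve_le_sum (hx : IsUnitPacking x) :
    (univ.filter fun i => coordination x i ≠ 12).card ≤ ∑ i, (12 - coordination x i) := by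
  rw [card_eq_sum_ones]
  calc ∑ i ∈ univ.filter (fun i => coordination x i ≠ 12), 1
      ≤ ∑ i ∈ univ.filter (fun i => coordination x i ≠ 12), (12 - coordination x i) := by
        refine sum_le_sum fun i hi => ?_
        have h1 := (mem_filter.1 hi).2
        have h2 := coordination_le_twelve hx i
        omega
    _ ≤ ∑ i, (12 - coordination x i) :=
        sum_le_sum_of_subset_of_nonneg (filter_subset _ _) fun _ _ _ => Nat.zero_le _

/-- **The counting lemma.** In a packing of unit-diameter balls in `ℝ³`, a set `S` of balls each
of which either has `≠ 12` contacts or has a contact neighbour with `≠ 12` contacts satisfies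
`|S| ≤ 12 · ∑ᵢ (12 - deg i)` (`= 12 (12N - 2E)`): `S ⊆ A ∪ ⋃_{a ∈ A} N(a)` with
`A = {deg ≠ 12}`, and `|N(a)| ≤ 11` on `A`. -/
theorem card_le_of_localTwelve (hx : IsUnitPacking x) (S : Finset (Fin N))
    (hS : ∀ i ∈ S, coordination x i = 12 → ∃ j ∈ contactNeighbors x i, coordination x j ≠ 12) :
    S.card ≤ 12 * ∑ i, (12 - coordination x i) := by
  classical
  set A : Finset (Fin N) := univ.filter fun i => coordination x i ≠ 12 with hA
  have hmemA : ∀ i, i ∈ A ↔ coordination x i ≠ 12 := fun i => by simp [hA]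
  have hsub : S ⊆ A ∪ A.biUnion fun a => contactNeighbors x a := by
    intro i hi
    by_cases h12 : coordination x i = 12
    · obtain ⟨j, hj, hj12⟩ := hS i hi h12
      exact mem_union_right _ (mem_biUnion.2 ⟨j, (hmemA j).2 hj12,
        (mem_contactNeighbors_comm x).1 hj⟩)
    · exact mem_union_left _ ((hmemA i).2 h12)
  have hdeg : ∀ a ∈ A, (contactNeighbors x a).card ≤ 11 := by
    intro a ha
    have h1 := (hmemA a).1 ha
    have h2 := coordination_le_twelve hx a
    rw [coordination] at h1 h2
    omega
  calc S.card ≤ (A ∪ A.biUnion fun a => contactNeighbors x a).card := card_le_card hsub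
    _ ≤ A.card + (A.biUnion fun a => contactNeighbors x a).card := card_union_le _ _
    _ ≤ A.card + ∑ a ∈ A, (contactNeighbors x a).card := by
        gcongr; exact card_biUnion_le
    _ ≤ A.card + ∑ a ∈ A, 11 := by gcongr with a ha; exact hdeg a ha
    _ = 12 * A.card := by rw [sum_const, smul_eq_mul]; ring
    _ ≤ 12 * ∑ i, (12 - coordination x i) :=
        Nat.mul_le_mul_left _ (card_coordination_ne_twelve_le_sum hx)

/-- In a sticky ground state the total coordination deficit is at most `108 · N^{2/3}`:
`∑ᵢ (12 - deg i) = 12N - 2 C(N) ≤ 108 N^{2/3}`. -/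
theorem sum_twelve_sub_coordination_le_of_groundState (hx : IsStickyGroundState x) :
    ((∑ i, (12 - coordination x i) : ℕ) : ℝ) ≤ 108 * (N : ℝ) ^ ((2 : ℝ) / 3) := by
  have h1 : ((∑ i, (12 - coordination x i) : ℕ) : ℝ) + 2 * (numContacts x : ℝ) = 12 * N := by
    exact_mod_cast sum_twelve_sub_coordination_add hx.1
  have h2 : (numContacts x : ℝ) = maxContacts 3 N := by exact_mod_cast hx.2
  have h3 := six_mul_sub_rpow_le_maxContacts N
  linarith

/-- **All but `108 · N^{2/3}` balls of a sticky ground state have exactly twelve contacts**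
(UNCONDITIONAL: kissing number + handshake + fcc deficit bound). In particular the balls at the
surface are `O(N^{2/3})` in number. -/
theorem card_coordination_ne_twelve_le_of_groundState (hx : IsStickyGroundState x) :
    ((univ.filter fun i => coordination x i ≠ 12).card : ℝ) ≤ 108 * (N : ℝ) ^ ((2 : ℝ) / 3) :=
  le_trans (by exact_mod_cast card_coordination_ne_twelve_le_sum hx.1)
    (sum_twelve_sub_coordination_le_of_groundState hx)

/-- **The counting lemma in a ground state**: a set of balls each under-coordinated or with an
under-coordinated neighbour has at most `1296 · N^{2/3}` members. -/
theorem card_le_of_localTwelve_of_groundState (hx : IsStickyGroundState x) (S : Finset (Fin N))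
    (hS : ∀ i ∈ S, coordination x i = 12 → ∃ j ∈ contactNeighbors x i, coordination x j ≠ 12) :
    (S.card : ℝ) ≤ 1296 * (N : ℝ) ^ ((2 : ℝ) / 3) := by
  have h1 : (S.card : ℝ) ≤ 12 * ((∑ i, (12 - coordination x i) : ℕ) : ℝ) := by
    exact_mod_cast card_le_of_localTwelve hx.1 S hS
  have h2 := sum_twelve_sub_coordination_le_of_groundState hx
  linarith

/-- **The reduction.** The local twelve-neighbour lemma implies bulk crystallization with the
explicit constant `K = 1296 = 24 · 54`: under `L12Local` every non-close-packed ball of a packing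
has `≠ 12` contacts or a contact neighbour with `≠ 12` contacts, and the counting lemma applies. -/
theorem bulkCrystallization3D_of_L12Local (h : L12Local) : BulkCrystallization3D 1296 := by
  intro N x hx
  refine card_le_of_localTwelve_of_groundState hx (nonClosePacked x) fun i hi h12 => ?_
  by_contra hall
  push Not at hall
  exact (mem_nonClosePacked.1 hi) (h N x hx.1 i h12 hall)

end Summit.Ventures.Crystal3D

end
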